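import Summits.QuantumFields.QCD.Theses.NestedDissectionSea
import Summits.QuantumFields.QCD.Theorems.NestedDissectionSeaSignDefectForcesCrossing
import Summits.QuantumFields.QCD.Theorems.FrameAndSeparatorLaw.Negative.LowerPinLoadBearing
import Summits.QuantumFields.QCD.Theorems.NestedDissectionSeaLightQuarkCompletionGlue
import HarnessLib.Audit

/-!
# Birth skeleton (BC3) for the crux `SeaFactorisationBridge` (item stmt-QuantumFields-17010)

Route `NestedDissectionSea` (sub-problem QCD), crux decl
`Summit.QuantumFields.QCD.Theses.NestedDissectionSea.SeaFactorisationBridge` as restated 2026-08-17 (route rev ≥ 32,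
route-repair on the crux-attack rattack-18065: THE THRESHOLD BRIDGE OVER FRAMED, BY-NAME HYPOTHESES
`RobustYangMillsRG → EarlyCrosserLaw → FrameAndSeparatorLaw → ∀ N_f ∈ {2,3}, ∃ reg, HMS ∧ HAS ∧ weak branch ∧ ∃ M₀ ≥ 0,
two-sided pin above M₀ ∧ QCDOf body above M₀`).  Registered by the skeleton-registrar seat
`planner-skel-stmt-QuantumFields-17010-0` (route re-audit bin HONEST-BET, 2026-08-17) as
`Cruxes/SeaFactorisationBridge/Lines/birth.lean`.  It is the route-level BIRTH CERTIFICATE of the restated crux (≥ 2 named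
stubs, kernel-checked composition concluding the crux BY NAME, sorries only inside `stub_*`), deliberately LINE-NEUTRAL:
the PURE-LOGIC part of the bridge — the FRAME CLOSURE that the repair made possible — is PROVED here
(`framedCoerciveLine_of_hypotheses`: THE LINE `EarlyCrosserLaw` hands over its own regularisation; (α) of
`FrameAndSeparatorLaw` fed with the two-sided pin frames it, `m_crit → 0`; (β) fed with the sign-defect dilution — from
(a′) by the PROVED `SignDefectForcesCrossing` — makes its separators coercive above `M₁ ≥ M₀` in a sub-window `ℓ' ≤ ℓ`),
and the RESIDUAL (the refuter's `Residual`/`ResidualSubseq` of Attack17010.lean, prover briefing (1)–(4)) is cut BY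
SECTOR along the tree's typed interfaces into three stubs:

* `stub_seaHandsOver : SeaHandsOverStmt` — (1) BOSONIC SEA FLOW into the premise format of `RobustYangMillsRG` with a
  convergent two-loop-exact block coupling + (3) SIGN (the blocked signed sea is a positive Bałaban density: dilution
  (ii) + decorrelation by separator coercivity) + the INSTANTIATION of #4: along a framed coercive line, above a threshold
  `M₂ ≥ M₁`, the signed sea has the gapped gluonic continuum limit `GluonicLimitAt` (the conclusion package of
  `RobustYangMillsRG` read on the sea functional `seaExpect`).  Consumes `RobustYangMillsRG` BY NAME.  Open-problem.
* `stub_quarkCompletion : QuarkCompletionStmt` — (2) HEAVY BLOCK INTEGRATION of the quark species at one heavy tuple: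
  gluonic limit + framed line ⇒ the `QCDOf` body along a subsequence (pseudoscalar species, flavoured/baryonic
  `HasLatticeMassGap`, OS assembly with E1 through the shared module `RotationRestoration`, stmt-8840).  Open / L.
* `stub_commonSubsequence : CommonSubsequenceStmt` — (4) `∀ m`-UNIFORMITY: per-tuple subsequential bodies above `M₂`
  assemble along ONE subsequence above `M₃ ≥ M₂` (`m`-equicontinuity uniformly in `k` + diagonal, or uniqueness).  L / open.

`SeaFactorisationBridge_of : SeaHandsOverStmt → QuarkCompletionStmt → CommonSubsequenceStmt → SeaFactorisationBridge` is
kernel-checked and NOT a one-line seam: frame closure; threshold bookkeeping `M₀ ≤ M₁ ≤ M₂ ≤ M₃`; the witness is the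
SUBSEQUENCE regularisation `reg.restrict φ` (the crux's `∃ reg` absorbs one common subsequence — the refuter's
`bridge_of_residualSubseq` reading), to which both scalings, the branch (hence the weak branch) and the two-sided pin
(threshold raised to `M₃`) are transported by the landed heredity lemmas (`StronglyChiralSubsequence.*_restrict`,
`LightQuarkJumpLine.pinClause_restrict/upperPin_restrict`); `seaFactorisationBridge_of_stubs` instantiates it.
`lean check --json`: rc 0, sorries 3 = the three `stub_*` (zero elsewhere), standard axioms + `sorryAx` in the stub cones only.

## Negative knowledge honoured (read 2026-08-17: `Cruxes/SeaFactorisationBridge/Disproof.lean` (13880-era, verdict NO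
## KILL, no `_false_without_` theorem); `Theorems/SeaFactorisationBridge/Negative/*` (9 landed lemmas);
## `Theorems/{EarlyCrosserLaw,FrameAndSeparatorLaw}/Negative/LowerPinLoadBearing`; item notes of 17010; dead lines of 13880)
* DEATH 1 of all three 13880 lines (proper-time-quarantine, superconfinement-carry, uv-sign-erasure: "hinge idle / missing
  frame on hypothesis 2", rattack-18065) cannot recur: the frame is DERIVED here, sorry-free, from the by-name hypotheses
  (`framedCoerciveLine_of_hypotheses`), exactly as the refuter's independent `frame_closure` (Attack17010.lean, gate-box
  evidence not readable from the hub — re-derived).  `Negative/RegPrefixOffBranch` (the `∃ reg` prefix gives no branch):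
  the branch `m_crit → 0` is supplied by (α), and the weak branch `−1 ≤ m_crit` of the conclusion is its corollary.
* LOWER PIN LOAD-BEARING in (α) (`FrameAndSeparatorLawNegative.frameWithoutLowerPin_false`,
  `EarlyCrosserLawNegative.not_earlyCrosserLawAt_heavyJunkReg`): the closure feeds `Frame` with `PinClause ∧ UpperPin`
  (`twoSidedPin_iff`), i.e. it USES the lower pin (b); no stub deletes it; the pins of the conclusion are THE LINE's own.
* `Negative/SubsequenceObstruction` (`∀ W ∃ φ` vs `∃ reg ∀ m`; `no_common_subsequence`): answered BY NAME — (S1)/(S2) are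
  per-tuple and subsequential, (S3) is the named `m`-uniformity statement, and the composition's witness is `reg.restrict φ`.
* `Negative/CouplingMismatch` (pure-gauge vs `N_f` profile, `(N_f/12π²) log a_k⁻² + 2Δ(b₁/b₀) log log a_k⁻²` apart): (S1)
  hands `RobustYangMillsRG` the BLOCK-SCALE effective coupling `βe_k` of the flowed sea (convergent, as rev 3 demands),
  never `reg.β` or a pure-gauge profile at spacing `a_k`; the two-loop-exact extraction is named as (S1)'s content.
* `Negative/DiluteSignModels` (+ Disproof §2, §7 `sign_lowerBound_needs_decorrelation`): marginal dilution transfers no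
  sign — (S1) names the decorrelation input (separator coercivity (β) + `KineticEdge` locality of the exactly local cell
  spins) as load-bearing for the positivity of the BLOCKED weight; no stub asserts a sign bound from dilution alone.
* `Negative/SupSmallCone`, `Negative/RobustYangMillsContainsYM`, `Negative/KillProfile`: about the D1-level `RobustYangMills`
  (13897) and the 13880 shape; the hypothesis is now the RG-level rev 3 (`RobustYangMillsRG`, stmt-18010) over SIGNED
  reflection-positive fine weights, consumed by (S1) by name (no instantiation "at `W ≡ 0` on the sea measure").
* `Negative/QuenchedReferenceTransport`, `Negative/WeightedClusterRatio` (audits of proper-time-quarantine's stubs r10–r12):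
  no stub here transports phase-quenched rarity to a reference sea or asserts an exponent-one weighted cluster property.
* Item-note CAVEAT (ATTACK.md §3.3, `supertrace_pairing_neg`): `AdmAt`'s reflection positivity cannot be met by the
  time-PERIODIC determinant weight — (S1) is worded for the all-directions-ANTIPERIODIC sea
  (`WilsonQCDSiteReflectionPositivityAP_holds`) with the AP→periodic transfer inside it; `seaExpect` (periodic, = the
  statement's `qcdTorusExpect` on gluonic observables) is only the READ-OUT functional of `GluonicLimitAt`.
* `ledger negatives --problem QuantumFields` (read 2026-08-17: 5 entries — RobustYangMillsRG rev 2 stmt-14958,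
  MirrorModularBoosts stmt-9665, AdaptiveCoarseSystem stmt-9494, MultibosonLatticeGap stmt-9599, AdmissibleRootsExist
  stmt-9603): no stub is equal or trivially equivalent to a refuted statement (all three are conditional on the framed
  line / the gluonic limit; none is an `∃ reg` lattice-gap claim).

## BC3 probes (planner folder `bc/birth_probe_<Stmt>.lean`, outputs `bc/probe_out_<Stmt>.txt`, 2026-08-17): for each stub
statement `S ∈ {SeaHandsOverStmt, QuarkCompletionStmt, CommonSubsequenceStmt}`, `S → SeaFactorisationBridge`, `S → QCD` and
`S` itself by `first | exact? | simpa | simpa [S] | (unfold S; simpa) | aesop` (maxHeartbeats 400000) all FAIL (rc 1, 3/3 × 3).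
-/

noncomputable section

namespace Summit.QuantumFields.QCD.Cruxes.SeaFactorisationBridge.Birth

open scoped BigOperators Topology Classical
open MeasureTheory Filter
open Literature.MathematicalPhysics.QuantumLattice Literature.MathematicalPhysics.AQFT
  Literature.MathematicalPhysics.QuantumFieldTheory Literature.Probability.LatticeModels
open Summit.QuantumFields.QCD.Theses.NestedDissectionSea
open Summit.QuantumFields.QCD.Theorems.CoerciveSeaNegative (PinClause)
open Summit.QuantumFields.QCD.Theorems.EarlyCrosserLawNegative (DilutionClause UpperPin EarlyCrosserLawAt
  earlyCrosserLaw_iff)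
open Summit.QuantumFields.QCD.Theorems.FrameAndSeparatorLawNegative (TwoSidedPin Frame
  frameAndSeparatorLaw_iff twoSidedPin_iff)
open Summit.QuantumFields.QCD.Cruxes.CoerciveOfDilute.SeaPaysPoles (SeparatorLawLarge)

/-! ## §0 Currency: clauses of the crux and of its hypotheses, verbatim -/

/-- **The `QCDOf` body at the tuple `m` along `reg`** — VERBATIM the last clause of the crux's conclusion
(and of `LightQuarkCompletion`'s hypothesis): OS data tied to lattice QCD along `reg.scheme m z shift`,
non-trivial non-Gaussian glue, non-decoupled flavour-changing pseudoscalars, one `Δ > 0` for `T.HasMassGap`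
and `HasLatticeMassGap`. -/
def BodyAt (Nf : ℕ) (reg : QCDRegularisation Nf) (m : Fin Nf → ℝ) : Prop :=
  ∃ (z shift : QCDField Nf → ℕ → ℝ) (T : OSData (QCDField Nf) 4), IsQCDAlong (reg.scheme m z shift) T ∧
    T.IsNontrivial QCDField.glue ∧ T.IsNonGaussian QCDField.glue ∧
      (∀ f g : Fin Nf, f ≠ g → T.IsNontrivial (QCDField.pseudoRe f g)) ∧
        ∃ Δ > 0, T.HasMassGap Δ ∧ (reg.scheme m z shift).HasLatticeMassGap Δ

/-- **Windowed local dilution of SIGN DEFECTS** at `(Nf, reg, b₀, ℓ, m, R)` — VERBATIM clause (a) of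
`NegativeCellsDilute` = clause (ii) of `CoerciveSea` = the dilution premise of `SeparatorLawLarge`: for every
`ε > 0`, eventually in `k`, on every odd torus of physical side `≥ R`, the phase-quenched probability that a
corner-`0` window box at dyadic scale `j` is a sign defect for some flavour is `≤ δ j`, `Σ_{j<J} δ j ≤ ε`. -/
def DefectDilutionAt (Nf : ℕ) (reg : QCDRegularisation Nf) (b₀ : ℕ) (ℓ : ℝ) (m : Fin Nf → ℝ) (R : ℝ) :
    Prop :=
  ∀ ε : ℝ, 0 < ε → ∀ᶠ k : ℕ in Filter.atTop, ∀ S : ℕ, R ≤ reg.a k * (2 * S + 1) → let N : ℕ := 2 * S + 1; let mq : Fin Nf → ℝ := fun f => reg.mcrit k + reg.a k * m f / reg.Zm k; let wt : GaugeConfig 4 N (Matrix.specialUnitaryGroup (Fin 3) ℂ) → ℝ := fun U => ∏ f, ‖fermionDet (wilsonDirac (fundamentalRep (Fin 3)) U (mq f) 1)‖; let P : (GaugeConfig 4 N (Matrix.specialUnitaryGroup (Fin 3) ℂ) → Prop) → ℝ := fun E => (∫ U, (if E U then (1 : ℝ) else 0) * wt U ∂(wilsonMeasure (d := 4) (L :=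 N) (fundamentalRep (Fin 3)) (reg.β k))) / (∫ U, wt U ∂(wilsonMeasure (d := 4) (L := N) (fundamentalRep (Fin 3)) (reg.β k))); let J : ℕ := Nat.log 2 (⌊ℓ / reg.a k⌋₊ / b₀) + 1; ∃ δ : ℕ → ℝ, ∑ j ∈ Finset.range J, δ j ≤ ε ∧ ∀ j < J, ∀ s : Fin 4 → ℕ, (∀ i, b₀ * 2 ^ j ≤ s i ∧ s i < b₀ * 2 ^ (j + 2) ∧ s i ≤ N ∧ (s i : ℝ) * reg.a k ≤ ℓ) → P (fun U => ∃ f, IsSignDefect U (mq f) j s) ≤ δ j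

/-- **The separator Wegner law on large window boxes** at `(Nf, reg, b₀, ℓ', m, R, S₀, C, α)` — VERBATIM the
eventuality concluding `SeparatorLawLarge` (= conjunct (β) of `FrameAndSeparatorLaw`): eventually in `k`, on every
odd torus of physical side `≥ R`, for roughly cubic corner-`0` boxes with `b₀ ≤ s_i ≤ N`, `s_i a_k ≤ ℓ'`, `s_i ≥ S₀`,
every flavour and every `t ∈ (0,1]`, the phase-quenched probability of a `(t/s₀)`-singular separator is `≤ C t^α`. -/
def SeparatorLawAt (Nf : ℕ) (reg : QCDRegularisation Nf) (b₀ : ℕ) (ℓ' : ℝ) (m : Fin Nf → ℝ) (R : ℝ) (S₀ : ℕ)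
    (C α : ℝ) : Prop :=
  ∀ᶠ k : ℕ in Filter.atTop, ∀ S : ℕ, R ≤ reg.a k * (2 * S + 1) → let N : ℕ := 2 * S + 1; let mq : Fin Nf → ℝ := fun f => reg.mcrit k + reg.a k * m f / reg.Zm k; let wt : GaugeConfig 4 N (Matrix.specialUnitaryGroup (Fin 3) ℂ) → ℝ := fun U => ∏ f, ‖fermionDet (wilsonDirac (fundamentalRep (Fin 3)) U (mq f) 1)‖; let P : (GaugeConfig 4 N (Matrix.specialUnitaryGroup (Fin 3) ℂ) → Prop) → ℝ := fun E => (∫ U, (if E U then (1 : ℝ) else 0) * wt U ∂(wilsonMeasure (d := 4) (L := N) (fundamentalRep (Fin 3)) (reg.β k))) / (∫ U, wt U ∂(wilsonMeasure (d := 4) (L := N) (fundamentalRep (Fin 3)) (reg.β k))); ∀ s : Fin 4 → ℕ, (∀ i, b₀ ≤ s i ∧ s i ≤ N ∧ (s i : ℝ) * reg.a k ≤ ℓ') → (∀ i, S₀ ≤ s i) → (∀ i j, s i ≤ 2 * s j) → ∀ f : Fin Nf, ∀ t : ℝ, 0 < t → t ≤ 1 → P (fun U => HasSingularSeparator U (mq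 f) s (t / s 0)) ≤ C * t ^ α

/-- **THE FRAMED COERCIVE LINE at `(Nf, reg)` with threshold `M₁`, leaf size `b₀`, dilution window `ℓ` and
separator window `ℓ' ≤ ℓ`** — exactly what the frame closure extracts from `EarlyCrosserLaw ∧ FrameAndSeparatorLaw`
along THE LINE's own regularisation (`framedCoerciveLine_of_hypotheses` below): both scalings; the physical branch
`m_crit(k) → 0` (conjunct (α) fed with the two-sided pin); and for every tuple `m > M₁`: on some physical size `R`,
(a′) early-crosser dilution, (ii) sign-defect dilution (from (a′) by the PROVED `SignDefectForcesCrossing`), (b) the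
lower and (b″) the upper parity pin above `M₁`; and on some physical size `R'`, the separator Wegner law on large
boxes in the sub-window `ℓ'` (conjunct (β) fed with (ii), (b) and the branch). Statement abbreviation, not a fact. -/
def FramedCoerciveLineAt (Nf : ℕ) (reg : QCDRegularisation Nf) (M₁ : ℝ) (b₀ : ℕ) (ℓ ℓ' : ℝ) : Prop :=
  reg.HasMassScaling ∧ (reg.scheme 0 0 0).HasAsymptoticScaling ∧ Filter.Tendsto reg.mcrit Filter.atTop (nhds 0) ∧
    0 ≤ M₁ ∧ 2 ≤ b₀ ∧ 0 < ℓ ∧ 0 < ℓ' ∧ ℓ' ≤ ℓ ∧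
      ∀ m : Fin Nf → ℝ, (∀ f, M₁ < m f) →
        (∃ R : ℝ, 0 < R ∧ DilutionClause Nf reg b₀ ℓ m R ∧ DefectDilutionAt Nf reg b₀ ℓ m R ∧
          PinClause Nf reg M₁ m R ∧ UpperPin Nf reg M₁ m R) ∧
        (∃ R' : ℝ, 0 < R' ∧ ∃ S₀ : ℕ, ∃ C : ℝ, 0 < C ∧ ∃ α : ℝ, 0 < α ∧ SeparatorLawAt Nf reg b₀ ℓ' m R' S₀ C α)

/-- **The SIGNED sea expectation of a gluonic function** `h` of the links, on the odd torus of side `2S+1`, at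
step `k` of the scheme of `reg` at the tuple `m`: `∫ h(U) Re ∏_f det D_W(U, m_f(k), 1) dμ_W^{β_k}(U) / ∫ Re ∏_f det
D_W dμ_W^{β_k}` (`μ_W` Wilson's `SU(3)` probability measure; the determinant is real by `γ₅`-hermiticity, so this IS
the lattice-QCD torus expectation `qcdTorusExpect` of the Grassmann-constant observable `h` once the Berezin
integral is evaluated — `qcdTorusExpect_eq_phaseQuenched` / `fermiIntegral_fermiBoltzmann`; junk `0/0 = 0`). -/
def seaExpect {Nf : ℕ} (reg : QCDRegularisation Nf) (m : Fin Nf → ℝ) (k S : ℕ)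
    (h : GaugeConfig 4 (2 * S + 1) ↥(Matrix.specialUnitaryGroup (Fin 3) ℂ) → ℝ) : ℝ :=
  (∫ U, h U * (∏ f, fermionDet (wilsonDirac (fundamentalRep (Fin 3)) U (reg.mcrit k + reg.a k * m f / reg.Zm k) 1)).re
      ∂(wilsonMeasure (d := 4) (L := 2 * S + 1) (fundamentalRep (Fin 3)) (reg.β k))) /
    ∫ U, (∏ f, fermionDet (wilsonDirac (fundamentalRep (Fin 3)) U (reg.mcrit k + reg.a k * m f / reg.Zm k) 1)).re
      ∂(wilsonMeasure (d := 4) (L := 2 * S + 1) (fundamentalRep (Fin 3)) (reg.β k))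

/-- **The gapped gluonic continuum limit of the sea at the tuple `m`** — the conclusion package of
`RobustYangMillsRG` READ ON THE QCD SEA of `reg` at `m` (its normalised weight-expectation `E k S` replaced by the
signed sea expectation `seaExpect reg m k S`, its cutoff data `(a, L)` by `(reg.a, reg.L)`): along a subsequence
`φ`, with species renormalisations `(c, sh)`, the smeared gauge-invariant gluonic species converge to a labelled
Schwinger family `T` with E0, E0′, E2, E3, E4 and translation invariance (rotations are NOT claimed — `RobustYangMillsRG`
rev 3 is rotation-free), non-trivial non-Gaussian curvature, `T.HasMassGap Δ`, and uniform exponential clustering of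
all pairs of gluonic species under the signed sea functional on every torus `2S+1 ≥ 2L_k+1`, with ONE rate `Δ`. -/
def GluonicLimitAt (Nf : ℕ) (reg : QCDRegularisation Nf) (m : Fin Nf → ℝ) : Prop :=
  let G := ↥(Matrix.specialUnitaryGroup (Fin 3) ℂ); let ρ : G →* Matrix (Fin 3) (Fin 3) ℂ := fundamentalRep (Fin 3); let r₃ : LatticeRep G := ⟨3, ρ, continuous_fundamentalRep _, fundamentalRep_injective _, fundamentalRep_mem_unitaryGroup⟩; let N : ℕ → ℕ := fun S => 2 * S + 1; let E : (k S : ℕ) → (GaugeConfig 4 (N S) G → ℝ) → ℝ := fun k S h => seaExpect reg m k S h; ∃ φ : ℕ → ℕ, StrictMono φ ∧ ∃ (c sh : YMSpecies G → ℕ → ℝ) (T : LabelledSchwingerFamily (YMSpecies G) (EuclideanSpace ℝ (Fin 4))) (Δ : ℝ), 0 < Δ ∧ (T.IsNormalized ∧ T.IsHermitian ∧ T.HasLinearGrowth ∧ T.IsReflectionPositive ∧ T.IsSymmetric ∧ T.HasClusterProperty ∧ ∀ (n : ℕ) (σ : Fin n → YMSpecies G) (v : EuclideanSpace ℝ (Fin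 4)) (F : SchwartzMap (Fin n → EuclideanSpace ℝ (Fin 4)) ℂ), IsOffDiagonal F → T n σ (translateMulti v F) = T n σ F) ∧ (∀ n, n ≠ 0 → ∀ (σ : Fin n → YMSpecies G) (f : Fin n → SchwartzMap (EuclideanSpace ℝ (Fin 4)) ℝ) F, IsTensorOf F (fun i => ofRealTest (f i)) → IsOffDiagonal F → Tendsto (fun j => let q := φ j; (E q (reg.L q) (fun U => ∏ i, smearedLatticeField (σ i).F (Literature.Probability.LatticeModels.box 4 (reg.L q)) (reg.a q) (c (σ i) q) (sh (σ i) q) (f i) (torusLift (N (reg.L q)) U)) : ℂ)) atTop (nhds (T n σ F))) ∧ (∃ (F₁ G₁ : SchwartzMap (Fin 1 → EuclideanSpace ℝ (Fin 4)) ℂ) (H₁ : SchwartzMap (Fin (1 + 1) → EuclideanSpace ℝ (Fin 4)) ℂ), IsTimeOrdered F₁ ∧ IsTimeOrdered G₁ ∧ IsAppendTensorOf H₁ (osAdjoint F₁) G₁ ∧ T (1 + 1) (fun _ => r₃.curvature) H₁ ≠ T 1 (fun _ => r₃.curvature) (osAdjoint F₁) * T 1 (fun _ => r₃.curvature) G₁)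 ∧ (∃ (f g h : SchwartzMap (EuclideanSpace ℝ (Fin 4)) ℂ) (Ffgh : SchwartzMap (Fin 3 → EuclideanSpace ℝ (Fin 4)) ℂ) (Fgh Ffh Ffg : SchwartzMap (Fin 2 → EuclideanSpace ℝ (Fin 4)) ℂ) (Ff Fg Fh : SchwartzMap (Fin 1 → EuclideanSpace ℝ (Fin 4)) ℂ), IsTensorOf Ffgh ![f, g, h] ∧ IsOffDiagonal Ffgh ∧ IsTensorOf Fgh ![g, h] ∧ IsTensorOf Ffh ![f, h] ∧ IsTensorOf Ffg ![f, g] ∧ IsTensorOf Ff ![f] ∧ IsTensorOf Fg ![g] ∧ IsTensorOf Fh ![h] ∧ T 3 (fun _ => r₃.curvature) Ffgh - T 1 (fun _ => r₃.curvature) Ff * T 2 (fun _ => r₃.curvature) Fgh - T 1 (fun _ => r₃.curvature) Fg * T 2 (fun _ => r₃.curvature) Ffh - T 1 (fun _ => r₃.curvature) Fh * T 2 (fun _ => r₃.curvature) Ffg + 2 * (T 1 (fun _ => r₃.curvature) Ff * T 1 (fun _ => r₃.curvature) Fg * T 1 (fun _ => r₃.curvature) Fh) ≠ 0) ∧ T.HasMassGap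 Δ ∧ ∀ A B : YMSpecies G, ∃ C, ∀ᶠ k in atTop, ∀ S, reg.L k ≤ S → ∀ n : ℕ, n ≤ S → |E k S (fun U => A.F (torusLift (N S) U) * B.F (configShift (-Pi.single 0 (n : ℤ)) (torusLift (N S) U))) - E k S (A.F ∘ torusLift (N S)) * E k S (B.F ∘ torusLift (N S))| ≤ C * Real.exp (-(Δ * (reg.a k * n)))


/-! ## §1 The three stub statements -/

/-- **(S1) THE SEA HANDS OVER — the gluonic sector above a threshold, through `RobustYangMillsRG`.**
Given RG-level robust `SU(3)` Yang–Mills and a framed coercive line `(Nf, reg, M₁, b₀, ℓ, ℓ')`, there is a threshold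
`M₂ ≥ M₁` such that at every tuple `m > M₂` the signed sea has the gapped gluonic continuum limit `GluonicLimitAt`.
Internal steps (the route's BosonicSeaFlow + SignedFromQuenched + the instantiation of #4): (1) BOSONIC SEA FLOW — the
separator activities `N_f log|det S_Σ(c)|` of the nested dissection (coercive by the separator law (β), small boxes
deterministic by `KineticEdge`) are flowed by a Bałaban block RG from `a_k` to the block scale `ℓ₀ = c/M₂ ≤ ℓ'`, landing
the ALL-DIRECTIONS-ANTIPERIODIC signed sea weight (reflection positive: fact `WilsonQCDSiteReflectionPositivityAP`) in
the premise format `AdmAt` of `RobustYangMillsRG` through a continuous, globally `cA`-coercive covariant averaging,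
with a CONVERGENT block coupling `βe_k ≥ β₀` whose extraction from the sea is two-loop exact
(`Negative/CouplingMismatch`: the pure-gauge and `N_f`-flavour profiles differ by `(N_f/12π²) log a_k⁻² + 2Δ(b₁/b₀)
log log a_k⁻² + C`; heavy quarks in block units, `M₂` large, make `βe_k ≥ β₀`); (3) SIGN — the format forces the
BLOCKED weight to be a positive Bałaban density, which needs the sign defects to be window-dilute (ii) AND decorrelated
under the phase-quenched law (`Negative/DiluteSignModels`: marginal dilution alone transfers nothing; the decorrelation
is the separator coercivity (β) + `KineticEdge` locality of the cell spins); then `RobustYangMillsRG` is INSTANTIATED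
and its conclusion transported from the antiperiodic to the periodic functional `seaExpect` (finite-size, heavy-mass
cluster grade). Why it might fail: landing determinant activities in the one-block format at `ℓ₀` is undone
(surface-extensive `Φ_c`); (β) holds only on large boxes in `ℓ'`, the flow must live with `ℓ'`, `S₀`; the AP→periodic
transfer needs the gap it is producing. Size: open-problem (contains no YM existence — that is the hypothesis). -/
def SeaHandsOverStmt : Prop :=
  RobustYangMillsRG → ∀ (Nf : ℕ) (reg : QCDRegularisation Nf) (M₁ : ℝ) (b₀ : ℕ) (ℓ ℓ' : ℝ), (Nf = 2 ∨ Nf = 3) →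
    FramedCoerciveLineAt Nf reg M₁ b₀ ℓ ℓ' →
      ∃ M₂ : ℝ, M₁ ≤ M₂ ∧ ∀ m : Fin Nf → ℝ, (∀ f, M₂ < m f) → GluonicLimitAt Nf reg m

/-- **(S2) QUARK-SPECIES COMPLETION at one tuple — the route's HeavyBlockIntegration.** Along a framed coercive
line, at a tuple `m > M₁` where the sea has the gapped gluonic limit (S1), the `QCDOf` body holds along a
SUBSEQUENCE of `reg` (the crux's `∃ reg` absorbs it): heavy-quark block integration at the block scale expresses the
quark species — the flavour-changing pseudoscalars `pseudoRe f g` = propagator insertions `adj D_W/det D_W`, and every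
gauge-invariant local lattice QCD observable of `HasLatticeMassGap` (mesons, baryons) — as quasi-local functionals of
the blocked gluonic field with exponentially decaying kernels (random-walk / Combes–Thomas bounds for `D_W⁻¹` at bare
masses heavy in block units, valid OFF the window-dilute sign-defect cells and patched across them by the separator
coercivity), so that (i) their lattice `n`-point functions converge along the gluonic subsequence, (ii) the uniform
gluonic clustering with rate `Δ` upgrades to the flavoured and baryonic `HasLatticeMassGap Δ'`, `Δ' = min(Δ, c·M₁)`,
(iii) `IsNontrivial (pseudoRe f g)` from the connected heavy-heavy meson two-point function at finite mass, and (iv)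
the OS data `OSData (QCDField N_f) 4` are ASSEMBLED from the rotation-free package of (S1) extended to the quark
species plus the shared QCD E1 module `RotationRestoration` (stmt-QuantumFields-8840: asymptotic scaling, `m_q > −1`
eventually, a lattice gap and convergence of `qcdLatticeSchwinger` ⇒ `SO(4)`-invariance on `⁰𝒮`) — an IMPORT of this
stub. Why it might fail: no hypothesis speaks of the fermionic sector — the heavy-quark expansion must be controlled
under the SIGNED measure inside defect cells; E1 only through 8840. Size: open-problem (L given (S1) and 8840). -/
def QuarkCompletionStmt : Prop :=
  ∀ (Nf : ℕ) (reg : QCDRegularisation Nf) (M₁ : ℝ) (b₀ : ℕ) (ℓ ℓ' : ℝ), (Nf = 2 ∨ Nf = 3) →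
    FramedCoerciveLineAt Nf reg M₁ b₀ ℓ ℓ' → ∀ m : Fin Nf → ℝ, (∀ f, M₁ < m f) → GluonicLimitAt Nf reg m →
      ∃ (φ : ℕ → ℕ) (hφ : StrictMono φ), BodyAt Nf (reg.restrict φ hφ.tendsto_atTop) m

/-- **(S3) ONE SUBSEQUENCE FOR ALL HEAVY TUPLES — the `∀ m`-uniformity** (`Negative/SubsequenceObstruction`:
per-tuple subsequences do not assemble into one scheme in the abstract; `no_common_subsequence`). Along a framed
coercive line, if every tuple above `M₂ ≥ M₁` carries the body along its own subsequence, then ONE subsequence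
carries it at every tuple above some `M₃ ≥ M₂`. Mechanism: `m`-EQUICONTINUITY of all lattice Schwinger functions and
connected correlators uniformly in `k` (volume-summed `ψ̄ψ`-insertion bounds in the flavour-singlet scalar channel,
controlled by the uniform lattice gap after `m`-dependent species renormalisation), a diagonal extraction over a
countable dense set of tuples, and continuity in `m` of the limiting OS data — equivalently, UNIQUENESS of the
continuum limit above threshold (universality), under which `φ = id` serves. Why it might fail: the gap, hence the
modulus of `m`-continuity, is not uniform as `m ↓ M₂` (whence `M₃ ≥ M₂` free); uniqueness is not in any hypothesis.
Size: L (equicontinuity route) / open (uniqueness route). -/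
def CommonSubsequenceStmt : Prop :=
  ∀ (Nf : ℕ) (reg : QCDRegularisation Nf) (M₁ : ℝ) (b₀ : ℕ) (ℓ ℓ' : ℝ), (Nf = 2 ∨ Nf = 3) →
    FramedCoerciveLineAt Nf reg M₁ b₀ ℓ ℓ' → ∀ M₂ : ℝ, M₁ ≤ M₂ →
      (∀ m : Fin Nf → ℝ, (∀ f, M₂ < m f) →
        ∃ (φ : ℕ → ℕ) (hφ : StrictMono φ), BodyAt Nf (reg.restrict φ hφ.tendsto_atTop) m) →
      ∃ (φ : ℕ → ℕ) (hφ : StrictMono φ), ∃ M₃ : ℝ, M₂ ≤ M₃ ∧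
        ∀ m : Fin Nf → ℝ, (∀ f, M₃ < m f) → BodyAt Nf (reg.restrict φ hφ.tendsto_atTop) m

/-! ## §2 The registered stubs (the ONLY `sorry`s of this file) -/

/-- (S1) the sea hands over: gluonic limit above a threshold along the framed coercive line — open-problem. -/
theorem stub_seaHandsOver : SeaHandsOverStmt := by
  sorry

/-- (S2) quark-species completion at one heavy tuple along a subsequence — open-problem / L given (S1). -/
theorem stub_quarkCompletion : QuarkCompletionStmt := by
  sorry

/-- (S3) one subsequence for all heavy tuples (`m`-uniformity) — size L / open. -/
theorem stub_commonSubsequence : CommonSubsequenceStmt := by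
  sorry

/-! ## §3 The frame closure (PROVED) and the composition (kernel-checked; no `sorry` below this line) -/

/-- **(ii) from (a′)**: windowed dilution of SIGN DEFECTS from windowed dilution of EARLY CROSSERS, by the PROVED
support `SignDefectForcesCrossing` (a sign defect of a window box puts a zero mode of the box or of one of its sixteen
children at a bare mass `≥` the valence mass) — the argument of the dropped support `DiluteOfEarlyCrossers`,
pointwise in `(m, R)`. -/
theorem defectDilution_of_dilutionClause {Nf : ℕ} (reg : QCDRegularisation Nf) (b₀ : ℕ) (ℓ : ℝ)
    (m : Fin Nf → ℝ) (R : ℝ) (h : DilutionClause Nf reg b₀ ℓ m R) : DefectDilutionAt Nf reg b₀ ℓ m R := by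
  intro ε hε
  filter_upwards [h ε hε] with k hk S hS
  obtain ⟨δ, -, hsum, hbox⟩ := hk S hS
  refine ⟨δ, hsum, fun j hj s hs => ?_⟩
  have key : ∀ U : GaugeConfig 4 (2 * S + 1) (Matrix.specialUnitaryGroup (Fin 3) ℂ),
      (∃ f : Fin Nf, IsSignDefect U (reg.mcrit k + reg.a k * m f / reg.Zm k) j s) →
        ∃ f : Fin Nf, ∃ μ' : ℝ, reg.mcrit k + reg.a k * m f / reg.Zm k ≤ μ' ∧
          ((wilsonCell U μ' 0 s).det = 0 ∨
            ∃ c : Fin 4 → Bool, (wilsonCell U μ' (halfCorner s c) (halfSides s c)).det = 0) := by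
    rintro U ⟨f, hdef⟩
    obtain ⟨μ', hμ', h'⟩ :=
      Summit.QuantumFields.QCD.Theorems.signDefectForcesCrossing_proof (2 * S + 1) U _ j s hdef
    exact ⟨f, μ', hμ', h'⟩
  exact hbox j hj s hs _ key

/-- The lower pin is monotone in its threshold. [folklore] -/
theorem pinClause_mono {Nf : ℕ} {reg : QCDRegularisation Nf} {M₀ M₁ : ℝ} (hle : M₀ ≤ M₁) {m : Fin Nf → ℝ}
    {R : ℝ} (h : PinClause Nf reg M₀ m R) : PinClause Nf reg M₁ m R :=
  fun M hM => h M (lt_of_le_of_lt hle hM)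

/-- The upper pin is monotone in its threshold. [folklore] -/
theorem upperPin_mono {Nf : ℕ} {reg : QCDRegularisation Nf} {M₀ M₁ : ℝ} (hle : M₀ ≤ M₁) {m : Fin Nf → ℝ}
    {R : ℝ} (h : UpperPin Nf reg M₀ m R) : UpperPin Nf reg M₁ m R :=
  fun M hM => h M (lt_of_le_of_lt hle hM)

/-- **THE FRAME CLOSURE** (the by-name repair of rattack-18065, re-derived: Death 1 "hinge idle / missing frame" does
not recur). From THE LINE `EarlyCrosserLaw` and `FrameAndSeparatorLaw`: for `N_f ∈ {2,3}` the line's OWN regularisation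
is a framed coercive line — (α) fed with the two-sided pin `(b) ∧ (b″)` gives `m_crit → 0`; (ii) comes from (a′) by
`SignDefectForcesCrossing`; (β) fed with (ii), (b) and the branch gives the separator law on large boxes above
`M₁ ≥ M₀` in a sub-window `ℓ' ≤ ℓ`; the pins pass from threshold `M₀` to `M₁`. Pure logic over the landed clause
decompositions `earlyCrosserLaw_iff`, `frameAndSeparatorLaw_iff`, `twoSidedPin_iff` (all `Iff.rfl`-grade). -/
theorem framedCoerciveLine_of_hypotheses (hE : EarlyCrosserLaw) (hF : FrameAndSeparatorLaw) :
    ∀ Nf : ℕ, (Nf = 2 ∨ Nf = 3) → ∃ (reg : QCDRegularisation Nf) (M₁ : ℝ) (b₀ : ℕ) (ℓ ℓ' : ℝ),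
      FramedCoerciveLineAt Nf reg M₁ b₀ ℓ ℓ' := by
  intro Nf hNf
  obtain ⟨reg, hms, has, M₀, hM₀, b₀, hb₀, ℓ, hℓ, hpkg⟩ := (earlyCrosserLaw_iff.1 hE) Nf hNf
  obtain ⟨hFrame, hSep⟩ := frameAndSeparatorLaw_iff.1 hF
  -- (α): the two-sided pin above `M₀` forces the physical branch
  have hcrit : Filter.Tendsto reg.mcrit Filter.atTop (nhds 0) := by
    refine hFrame Nf reg hNf hms has M₀ hM₀ fun m hmm => ?_
    obtain ⟨R, hR, -, hpin, hup⟩ := hpkg m hmm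
    exact ⟨R, hR, (twoSidedPin_iff Nf reg M₀ m R).2 ⟨hpin, hup⟩⟩
  -- (β): fed with (ii) (from (a′)) and (b) along the branch
  obtain ⟨M₁, h01, ℓ', hℓ', hℓ'ℓ, hsep⟩ :=
    hSep Nf reg hNf hms has hcrit M₀ hM₀ b₀ hb₀ ℓ hℓ fun m hmm => by
      obtain ⟨R, hR, hdil, hpin, -⟩ := hpkg m hmm
      exact ⟨R, hR, defectDilution_of_dilutionClause reg b₀ ℓ m R hdil, hpin⟩
  refine ⟨reg, M₁, b₀, ℓ, ℓ', hms, has, hcrit, hM₀.trans h01, hb₀, hℓ, hℓ', hℓ'ℓ, fun m hm => ⟨?_, ?_⟩⟩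
  · have hmm : ∀ f, M₀ < m f := fun f => lt_of_le_of_lt h01 (hm f)
    obtain ⟨R, hR, hdil, hpin, hup⟩ := hpkg m hmm
    exact ⟨R, hR, hdil, defectDilution_of_dilutionClause reg b₀ ℓ m R hdil, pinClause_mono h01 hpin,
      upperPin_mono h01 hup⟩
  · obtain ⟨R', hR', S₀, C, hC, α, hα, hlaw⟩ := hsep m hm
    exact ⟨R', hR', S₀, C, hC, α, hα, hlaw⟩

/-- The weak branch clause from the physical branch. [folklore] -/
theorem weakBranch_of_tendsto {Nf : ℕ} (reg : QCDRegularisation Nf)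
    (h : Filter.Tendsto reg.mcrit Filter.atTop (nhds 0)) : ∀ᶠ k : ℕ in Filter.atTop, -1 ≤ reg.mcrit k :=
  (h.eventually (eventually_gt_nhds (by norm_num : (-1 : ℝ) < 0))).mono fun _ hk => hk.le

open Summit.QuantumFields.QCD.Theorems.StronglyChiralSubsequence (hasMassScaling_restrict
  hasAsymptoticScaling_restrict)
open Summit.QuantumFields.QCD.Theorems.LightQuarkJumpLine (pinClause_restrict upperPin_restrict)

/-- **The crux from the three stubs** (concludes `SeaFactorisationBridge` BY NAME). Frame closure along THE LINE's
regularisation `reg`; (S1) gives the gluonic limit above `M₂ ≥ M₁`; (S2) the body at each tuple above `M₂` along a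
tuple-dependent subsequence; (S3) one subsequence `φ` above `M₃ ≥ M₂`. The witness is `reg.restrict φ` with threshold
`M₃`: both scalings, the branch (hence the weak branch `−1 ≤ m_crit` eventually) and the two-sided pin (threshold
raised from `M₁` to `M₃`) pass to the subsequence by the landed heredity lemmas; the body is (S3)'s. -/
theorem SeaFactorisationBridge_of :
    SeaHandsOverStmt → QuarkCompletionStmt → CommonSubsequenceStmt →
      Summit.QuantumFields.QCD.Theses.NestedDissectionSea.SeaFactorisationBridge := by
  intro hA hB hC hY hE hF Nf hNf
  obtain ⟨reg, M₁, b₀, ℓ, ℓ', hline⟩ := framedCoerciveLine_of_hypotheses hE hF Nf hNf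
  obtain ⟨M₂, h12, hglu⟩ := hA hY Nf reg M₁ b₀ ℓ ℓ' hNf hline
  have hper : ∀ m : Fin Nf → ℝ, (∀ f, M₂ < m f) →
      ∃ (φ : ℕ → ℕ) (hφ : StrictMono φ), BodyAt Nf (reg.restrict φ hφ.tendsto_atTop) m :=
    fun m hm => hB Nf reg M₁ b₀ ℓ ℓ' hNf hline m (fun f => lt_of_le_of_lt h12 (hm f)) (hglu m hm)
  obtain ⟨φ, hφ, M₃, h23, hbody⟩ := hC Nf reg M₁ b₀ ℓ ℓ' hNf hline M₂ h12 hper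
  obtain ⟨hms, has, hcrit, hM₁, -, -, -, -, hpkg⟩ := hline
  have h13 : M₁ ≤ M₃ := h12.trans h23
  refine ⟨reg.restrict φ hφ.tendsto_atTop, hasMassScaling_restrict reg φ hφ hms,
    hasAsymptoticScaling_restrict reg φ hφ has, ?_, M₃, hM₁.trans h13, ?_, ?_⟩
  · -- the weak branch along the subsequence
    exact weakBranch_of_tendsto _ (hcrit.comp hφ.tendsto_atTop)
  · -- the two-sided pin above `M₃` along the subsequence
    intro m hm
    obtain ⟨⟨R, hR, -, -, hpin, hup⟩, -⟩ := hpkg m (fun f => lt_of_le_of_lt h13 (hm f))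
    exact ⟨R, hR, pinClause_restrict reg φ hφ (pinClause_mono h13 hpin),
      upperPin_restrict reg φ hφ (upperPin_mono h13 hup)⟩
  · -- the body above `M₃`
    intro m hm
    exact hbody m hm

/-- The crux along this skeleton, from the registered stubs (sorries only inside `stub_*`). -/
theorem seaFactorisationBridge_of_stubs :
    Summit.QuantumFields.QCD.Theses.NestedDissectionSea.SeaFactorisationBridge :=
  SeaFactorisationBridge_of stub_seaHandsOver stub_quarkCompletion stub_commonSubsequence

end Summit.QuantumFields.QCD.Cruxes.SeaFactorisationBridge.Birth

end
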